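import Summits.MatrixMultiplication.MatrixMultiplication.Theses.CondensationDistance
import Literature.Computability.AlgebraicComplexity.DeterminantalIdealComplexity

/-!
# Crux `DerivationsBoundOmega` (stmt-MatrixMultiplication-15940) — birth skeleton, line `birth` (BC3)

Route `route-MatrixMultiplication-CondensationDistance`, crux (rank 6), the LITERATURE BRIDGE

  `DerivationsBoundOmega : ∀ τ ≥ 2, (∃ C n₀, ∀ n ≥ n₀, ∃ m' (h : n ≤ m') s, s ≤ C·n^τ ∧
      Derivable ℂ s (entries of the generic n × m' matrix Z = [X | Y]) {det X}) → omega ℂ ≤ τ`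

— "ω ≤ ω(Det)" (Bürgisser–Clausen–Shokrollahi 1997, Thm. (16.7), second half) in the tree's
currencies: the semantic SLP-with-division cost predicate `Derivable` (DivisionSLP.lean, BCS
Def. (4.4)/(4.7), ALL Ω-steps counted) on the hypothesis side, the tensor-RANK exponent `omega`
(MatrixMultiplicationExponent.lean) on the conclusion side.

THE LINE (the modern proof, every stub a theorem that is IN THE TREE or one bookkeeping step from it —
grounder g50-1's "shorter in-tree path", checked here to compose): divisions are removed up to a
nonzero polynomial FACTOR (Strassen 1973 numerator/denominator pairs) instead of exactly (BCS (7.1) at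
a good point), which lands the determinant program on a nonzero member `q · det X` of the determinantal
ideal `I^det_{n,m',n}` of the generic `n × m'` matrix — exactly the hypothesis of Andrews' lifting
theorem (FOCS 2022, Thm. 3: border rank of `⟨⌊n/4⌋⟩³` ≤ 6 · complexity), and Bini's theorem turns the
border-rank bound into `omega ≤ τ`. No good point, no Baur–Strassen in the division model, no `m'`
specialisation is needed: the auxiliary columns `Y` are simply more variables of the ideal's ring.

* `stub_pairsSimulation` — Strassen 1973 (Vermeidung von Divisionen, pairs form; BCS §7.1): a
  derivation of `det X` of length `s` over `ℂ(Z)` from the entries of `Z` yields a nonzero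
  `q ∈ ℂ[Z]` with `complexity (q · det X) ≤ 4s` (division-free fan-in-two circuit SIZE, ArithCircuit.lean).
  IN TREE: `Summit.MatrixMultiplication.MatrixMultiplication.Theorems.stub_pairs`
  (Theorems/HiddenToeplitzCornersToeplitzLikeDetCostPairs.lean, PROVED) with `l = []` and
  `Derivable.mono` (`Set.range (algebraMap ∘ X) ⊆ algebraMap '' freeInputs`).
* `stub_andrewsLeadingBlock` — Andrews 2022, Thm. 3 for the nonzero ideal member `q · det X`,
  `X` the leading `4t × 4t` block of the generic `4t × m'` matrix: `bR(⟨t,t,t⟩) ≤ 6 · complexity (q · det X)`.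
  IN TREE: `Andrews2022_thm3_holds` (DeterminantalIdealComplexityProofs.lean, DISCHARGED) at
  `(F, n, m, r) = (ℂ, 4t, m', 4t)` with `det_submatrix_mem_detIdeal id (Fin.castLE h)`, `Ideal.mul_mem_left`,
  nonvanishing of the leading minor (rename to `Matrix.det_mvPolynomialX_ne_zero`), and `4t/4 = t`.
* `stub_borderRankExponent` — Bini 1980 / Bläser 2013 Thm. 6.6 in exponent form: a bound
  `bR(⟨q,q,q⟩) ≤ A · q^τ` for all large `q` gives `omega ℂ ≤ τ`. IN TREE up to limit bookkeeping:
  `Blaser2013_thm66_holds.cubic` (`omega ≤ log_q r`), then `log_q (A q^τ) = τ + log A / log q → τ`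
  (cf. the `closes` proof of route DeterminantalIdealExponent, which does exactly this bookkeeping).
* `DerivationsBoundOmega_of_stubs` — the glue as an explicit implication
  `<stub₁> → <stub₂> → <stub₃> → <body of DerivationsBoundOmega, verbatim>` (conclusion = the crux
  statement unfolded, so that only `DerivationsBoundOmega_of` concludes the crux BY NAME — the
  skeleton checker takes the first theorem concluding the crux by name), a REAL proof: given `τ ≥ 2`,
  `C, n₀`, feed `stub_borderRankExponent` with `A := 24·|C|·4^τ`, `q₀ := n₀`; for `q ≥ n₀` take
  `n := 4q ≥ n₀`, get `m', h, s`; stub 1 gives `q' ≠ 0` with `complexity ≤ 4s`, stub 2 gives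
  `bR(⟨q,q,q⟩) ≤ 24s ≤ 24·C·(4q)^τ ≤ 24|C|·4^τ·q^τ` (`Real.mul_rpow`).
* `DerivationsBoundOmega_of : DerivationsBoundOmega` — the REGISTERED skeleton theorem (A12 shape:
  concludes the crux BY NAME, no hypotheses, `sorry` only inside the three declared stubs).

Imports are STATEMENT-LEVEL only (the route file; `DeterminantalIdealComplexity` for `complexity`,
`algBorderRank`, `detIdeal`, the fact `Andrews2022_thm3` as a `def`): the proof files
(`DeterminantalIdealComplexityProofs`, `SchoenhageTauBini`, the Theorems file with `stub_pairs`) are NOT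
imported, so the BC3 probes test the stubs, not the library — and so that this workfile does not
depend on a 1000-line proof cone it does not need to state its plan.

ALTERNATIVE LINE (unregistered, kept for a strategist): the printed BCS (16.7) chain itself — drop the
auxiliary columns (Ex. 4.4) → det ⇒ inverse (Cor. (7.9), Baur–Strassen in the `Derivable` model,
`5s + n² + 1`) → inverse ⇒ ONE division-free NONSCALAR sequence of length `≤ L` spanning the entries
of `X²` (Thm. (7.1) `d = 2` at a good point; the total→nonscalar switch is forced: BCS's translation
`A ↦ Aξ` is free only in `c_*`) → `R(⟨m,m,m⟩) ≤ 2L` (ψ-substitution + `exists_triads_of_isNonscalarSeq`)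
— elaborates with a proved composition too (evidence file `DerivationsBoundOmega_bcs167.lean` on the
item, namespace `…Cruxes.DerivationsBoundOmega.Bcs167`); two of its four stubs are L-sized and
unvendored, which is why it is not the registered plan.

Disproof used: none exists for this crux (`ledger crux ls stmt-MatrixMultiplication-15940`: no
Disproof.lean); the summit's negatives index has no statement about `Derivable`/`omega` bridges.
-/

-- the tree's namespace `Summit.MatrixMultiplication.MatrixMultiplication.…` repeats a component by design
set_option linter.dupNamespace false

noncomputable section

namespace Summit.MatrixMultiplication.MatrixMultiplication.Cruxes.DerivationsBoundOmega.Birth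

open Literature.Computability.AlgebraicComplexity
open Summit.MatrixMultiplication.MatrixMultiplication.Theses.CondensationDistance (DerivationsBoundOmega)

/-- **Stub 1 — Strassen's numerator/denominator simulation (Vermeidung von Divisionen, pairs form).**
If `det X` — `X` the leading `n × n` block of the generic `n × m'` matrix `Z`, viewed in `ℂ(Z)` — is
derivable in `s` steps (linear combinations, products, inverses of nonzero elements; constants free)
from the entries of `Z`, then some NONZERO multiple `q · det X`, `q ∈ ℂ[Z]`, is computed by a
division-free fan-in-two arithmetic circuit of size `≤ 4s`: carry every intermediate rational function
as a pair (numerator, denominator) of polynomials; `c•(a/b) + d•(a'/b') = (c a b' + d a' b)/(b b')`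
costs 3 gates (two products, one weighted sum) + 1, `(a/b)(a'/b')` costs 2, `(a/b)⁻¹ = b/a` costs 0.
Why plausibly true: it is Strassen 1973, §2 (BCS 1997, proof idea of Thm. (7.1) before the Taylor
refinement) and it is PROVED IN TREE in exactly this model:
`Summit.MatrixMultiplication.MatrixMultiplication.Theorems.stub_pairs`
(Theorems/HiddenToeplitzCornersToeplitzLikeDetCostPairs.lean: `Derivable ℂ n (algebraMap '' (freeInputs
∪ l)) B ∋ f ⇒ ∃ q ≠ 0, complexity (q * f) ≤ |l| + 4n`; take `l = []` and enlarge the available set by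
`Derivable.mono`, `Set.range (algebraMap ∘ X) ⊆ algebraMap '' freeInputs ℂ _`). Size: XS given the
tree (M on paper). Leans on: `Derivable` (DivisionSLP.lean), `complexity` (ArithCircuit.lean),
`freeInputs` (MatMulTotalComplexityProofs.lean). [cite: Strassen1973, §2; BurgisserClausenShokrollahi1997, §7.1] -/
theorem stub_pairsSimulation :
    ∀ (n m' : ℕ) (h : n ≤ m') (s : ℕ),
      Derivable ℂ s
        (Set.range fun p : Fin n × Fin m' =>
          algebraMap (MvPolynomial (Fin n × Fin m') ℂ) (FractionRing (MvPolynomial (Fin n × Fin m') ℂ))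
            (MvPolynomial.X p))
        {algebraMap (MvPolynomial (Fin n × Fin m') ℂ) (FractionRing (MvPolynomial (Fin n × Fin m') ℂ))
          (Matrix.det (Matrix.of fun i j : Fin n => MvPolynomial.X (i, Fin.castLE h j)))} →
      ∃ q : MvPolynomial (Fin n × Fin m') ℂ, q ≠ 0 ∧
        complexity (q * Matrix.det (Matrix.of fun i j : Fin n => MvPolynomial.X (i, Fin.castLE h j))) ≤
          4 * s := by
  sorry

/-- **Stub 2 — Andrews' lifting theorem for nonzero multiples of the leading minor (Andrews 2022,
Thm. 3, at `(F, n, m, r) = (ℂ, 4t, m', 4t)`).** For the generic `4t × m'` matrix `Z` (`4t ≤ m'`), its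
leading `4t × 4t` block `X`, and any nonzero `q ∈ ℂ[Z]`: the border rank (over `ℂ[ε]`, `algBorderRank`) of
the matrix multiplication tensor `⟨t,t,t⟩` is at most `6 · complexity (q · det X)`. Why plausibly true:
`det X = det (Z.submatrix id (Fin.castLE h))` is a `4t × 4t` minor of `Z`, so `q · det X ∈ I^det_{4t,m',4t}`
(`det_submatrix_mem_detIdeal`, `Ideal.mul_mem_left`), it is nonzero (`ℂ[Z]` is a domain; the minor
renames to `det` of a generic square matrix, `Matrix.det_mvPolynomialX_ne_zero`), and Andrews' Thm. 3 —
DISCHARGED IN TREE as `Andrews2022_thm3_holds` (DeterminantalIdealComplexityProofs.lean; straightening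
law + trace-ABP gadget + Baur–Strassen + `R̲ ≤ 2 C̲_×`) — gives `bR(⟨4t/4, 4t/4, 4t/4⟩) ≤ 6 · complexity`;
`4t/4 = t`. Size: XS given the tree (XL on paper). Leans on: `Andrews2022_thm3_holds`,
`det_submatrix_mem_detIdeal`, `algBorderRank`, `matMulTensor`, `complexity` (tree);
`Matrix.det_mvPolynomialX_ne_zero`, `MvPolynomial.rename` (Mathlib).
[cite: Andrews2022, Thm. 3; AndrewsForbes2022, Prop. 3.5] -/
theorem stub_andrewsLeadingBlock :
    ∀ (t m' : ℕ) (h : 4 * t ≤ m') (q : MvPolynomial (Fin (4 * t) × Fin m') ℂ), q ≠ 0 →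
      algBorderRank (matMulTensor ℂ t t t) ≤
        6 * complexity (q * Matrix.det (Matrix.of fun i j : Fin (4 * t) => MvPolynomial.X (i, Fin.castLE h j))) := by
  sorry

/-- **Stub 3 — Bini's theorem in exponent form (Bini 1980; Bläser 2013, Thm. 6.6).** If the border
rank of `⟨q,q,q⟩` is `≤ A · q^τ` for all large `q`, then `omega ℂ ≤ τ`. Why plausibly true: Bläser's
Thm. 6.6 in cubic form, PROVED IN TREE (`Blaser2013_thm66_holds.cubic`: `bR(⟨q,q,q⟩) ≤ r`, `q ≥ 2`,
`r ≥ 1` ⇒ `omega ≤ log_q r`), applied with `r = ⌈max A 1 · q^τ⌉₊ ≤ 2 max A 1 · q^τ`: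
`omega ≤ τ + log (2 max A 1) / log q` for all large `q`, and the error term tends to `0`
(`le_of_forall_pos_le_add`; the same bookkeeping closes route DeterminantalIdealExponent). Size: S/M
given the tree. Leans on: `Blaser2013_thm66_holds`, `Blaser2013_thm66.cubic`, `algBorderRank`,
`omega` (tree); `Real.logb_le_logb_of_le`, `Real.logb_rpow`, `Real.logb_mul` (Mathlib).
[cite: Blaser2013, Thm. 6.6; Bini1980] -/
theorem stub_borderRankExponent :
    ∀ τ : ℝ, (∃ A : ℝ, ∃ q₀ : ℕ, ∀ q ≥ q₀,
        (algBorderRank (matMulTensor ℂ q q q) : ℝ) ≤ A * (q : ℝ) ^ τ) →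
      omega ℂ ≤ τ := by
  sorry

/-- **Composition with explicit hypotheses (kernel-checked): stub 1 → stub 2 → stub 3 → the crux
statement** (conclusion = the body of `DerivationsBoundOmega` verbatim, so that only
`DerivationsBoundOmega_of` below concludes the crux by name). Given `τ ≥ 2` and the hypothesis'
`C, n₀`, apply stub 3 with `A := 24·|C|·4^τ`, `q₀ := n₀`: for `q ≥ n₀`, `n := 4q ≥ n₀` has a
derivation of `det X` of length `s ≤ C·(4q)^τ`; stub 1 gives `q' ≠ 0` with `complexity (q'·det X) ≤ 4s`;
stub 2 gives `bR(⟨q,q,q⟩) ≤ 24 s ≤ 24·|C|·4^τ·q^τ`. [cite: Andrews2022, Thm. 3; Blaser2013, Thm. 6.6] -/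
theorem DerivationsBoundOmega_of_stubs
    (h1 : ∀ (n m' : ℕ) (h : n ≤ m') (s : ℕ),
      Derivable ℂ s
        (Set.range fun p : Fin n × Fin m' =>
          algebraMap (MvPolynomial (Fin n × Fin m') ℂ) (FractionRing (MvPolynomial (Fin n × Fin m') ℂ))
            (MvPolynomial.X p))
        {algebraMap (MvPolynomial (Fin n × Fin m') ℂ) (FractionRing (MvPolynomial (Fin n × Fin m') ℂ))
          (Matrix.det (Matrix.of fun i j : Fin n => MvPolynomial.X (i, Fin.castLE h j)))} →
      ∃ q : MvPolynomial (Fin n × Fin m') ℂ, q ≠ 0 ∧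
        complexity (q * Matrix.det (Matrix.of fun i j : Fin n => MvPolynomial.X (i, Fin.castLE h j))) ≤
          4 * s)
    (h2 : ∀ (t m' : ℕ) (h : 4 * t ≤ m') (q : MvPolynomial (Fin (4 * t) × Fin m') ℂ), q ≠ 0 →
      algBorderRank (matMulTensor ℂ t t t) ≤
        6 * complexity (q * Matrix.det (Matrix.of fun i j : Fin (4 * t) => MvPolynomial.X (i, Fin.castLE h j))))
    (h3 : ∀ τ : ℝ, (∃ A : ℝ, ∃ q₀ : ℕ, ∀ q ≥ q₀,
        (algBorderRank (matMulTensor ℂ q q q) : ℝ) ≤ A * (q : ℝ) ^ τ) →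
      omega ℂ ≤ τ) :
    ∀ τ : ℝ, 2 ≤ τ →
      (∃ C : ℝ, ∃ n₀ : ℕ, ∀ n ≥ n₀, ∃ (m' : ℕ) (h : n ≤ m') (s : ℕ), (s : ℝ) ≤ C * (n : ℝ) ^ τ ∧
        Derivable ℂ s
          (Set.range fun p : Fin n × Fin m' =>
            algebraMap (MvPolynomial (Fin n × Fin m') ℂ) (FractionRing (MvPolynomial (Fin n × Fin m') ℂ))
              (MvPolynomial.X p))
          {algebraMap (MvPolynomial (Fin n × Fin m') ℂ) (FractionRing (MvPolynomial (Fin n × Fin m') ℂ))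
            (Matrix.det (Matrix.of fun i j : Fin n => MvPolynomial.X (i, Fin.castLE h j)))}) →
      omega ℂ ≤ τ := by
  intro τ _hτ hyp
  obtain ⟨C, n₀, hC⟩ := hyp
  refine h3 τ ⟨24 * |C| * (4 : ℝ) ^ τ, n₀, fun q hq => ?_⟩
  -- the hypothesis at size `n = 4q ≥ n₀`
  obtain ⟨m', h, s, hs, hD⟩ := hC (4 * q) (by omega)
  -- stub 1: a nonzero multiple of `det X` of division-free complexity `≤ 4s`
  obtain ⟨q', hq', hcx⟩ := h1 (4 * q) m' h s hD
  -- stub 2: Andrews' lifting at `t = q`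
  have hbr := h2 q m' h q' hq'
  have hbrs : algBorderRank (matMulTensor ℂ q q q) ≤ 24 * s := hbr.trans (by omega)
  -- real bookkeeping: `24 s ≤ 24 C (4q)^τ ≤ 24 |C| 4^τ q^τ`
  have hq0 : (0 : ℝ) ≤ (q : ℝ) := by positivity
  have hpow : (0 : ℝ) ≤ (4 * (q : ℝ)) ^ τ := Real.rpow_nonneg (by positivity) _
  have hsR : (s : ℝ) ≤ |C| * (4 * (q : ℝ)) ^ τ := by
    have hs' : (s : ℝ) ≤ C * (4 * (q : ℝ)) ^ τ := by
      have := hs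
      push_cast at this
      exact this
    exact hs'.trans (mul_le_mul_of_nonneg_right (le_abs_self C) hpow)
  have h4q : (4 * (q : ℝ)) ^ τ = (4 : ℝ) ^ τ * (q : ℝ) ^ τ := Real.mul_rpow (by norm_num) hq0
  calc (algBorderRank (matMulTensor ℂ q q q) : ℝ) ≤ ((24 * s : ℕ) : ℝ) := by exact_mod_cast hbrs
    _ = 24 * (s : ℝ) := by push_cast; ring
    _ ≤ 24 * (|C| * (4 * (q : ℝ)) ^ τ) := by nlinarith [hsR]
    _ = 24 * |C| * (4 : ℝ) ^ τ * (q : ℝ) ^ τ := by rw [h4q]; ring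

/-- **The registered skeleton theorem: `DerivationsBoundOmega` from the three declared stubs.**
Concludes the route crux
`Summit.MatrixMultiplication.MatrixMultiplication.Theses.CondensationDistance.DerivationsBoundOmega`
BY NAME with no hypotheses; its only `sorry`s are inside `stub_pairsSimulation`,
`stub_andrewsLeadingBlock`, `stub_borderRankExponent` (closing the three stubs closes the crux; all three
are in tree up to instantiation, see their docstrings). [cite: Andrews2022, Thm. 3] -/
theorem DerivationsBoundOmega_of : DerivationsBoundOmega :=
  DerivationsBoundOmega_of_stubs stub_pairsSimulation stub_andrewsLeadingBlock stub_borderRankExponent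

end Summit.MatrixMultiplication.MatrixMultiplication.Cruxes.DerivationsBoundOmega.Birth

end
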